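import Summits.BirchSwinnertonDyer.BirchSwinnertonDyer.Theorems.SylvesterTwoHeegnerIndexUpperPairForm
import Literature.NumberTheory.EllipticCurves.BSDShaProofs
import HarnessLib

/-!
# Route `SylvesterTwoHeegnerIndex` (rung K7t): BOTH halves of `BSD(E_p, 2)` on 𝒞_HSY are RIGID TO
# ONE BIT — Cassels–Tate squareness + the pair parity absorb a defect of one factor `2`

HONEST FRAMING (cell «bsd-cm», D-0033 tranche 1a; D-0074 seat `bsd-cm-k7t-c3` gen 5; item of record
stmt-BirchSwinnertonDyer-19477 `HeegnerIndexLowerAtTwoHSYOfFacts` = crux r3, the facts-conditional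
twin of 19230; by-catch the UPPER twins 19476 / 19725 and their off-`𝒱₀` child 19581). The LOWER
half of `BSD(E_p, 2)` on the Sylvester family 𝒞_HSY (`E_p : x³ + y³ = p`, `p ≡ 4, 7 (mod 9)` prime,
`3 ∉ 𝔽_p^{×3}`) — the main-conjecture / Kolyvagin-structure direction `ord₂ #Ш_an(E_p) ≤
ord₂ #Ш(E_p)` — is OPEN AS A CLASS (B14 = O12) and STAYS OPEN here: «find: 19230» = NOT FOUND (seat
gens 0–5). This file proves no member and no class case of either half. It is sorry-free and
binder-free (hypotheses = the route's published conjuncts BY NAME + the Cassels–Tate squareness fact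
`WeierstrassCurve.exists_casselsTate_pairing` + the route's pair-parity item `TwoAdicPairHSY`) and
proves that **both halves are equivalent to their own ONE-BIT WEAKENINGS.** In Hu–Shu–Yin pair form
(`…UpperPairForm`: for globally minimal `B ≅ E_p`, `A ≅ E_{3p²}`, LOWER at `B` ⟺
`ord₂ (#Ш_an(B)·#Ш_an(A)) ≤ ord₂ #Ш(B)[2^∞] + ord₂ #Ш(A)[2^∞]`, UPPER ⟺ the reverse inequality) all
three quantities are EVEN: `ord₂ (#Ш_an(B)·#Ш_an(A)) = 2n` is `TwoAdicPairHSY` (19580; memo two Thm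
B′/B″ + C, kernel modulo Hu–Shu–Yin's display, p456911), and `ord₂ #Ш(B)`, `ord₂ #Ш(A)` are even
because a finite `Ш` has square order (Cassels–Tate; `Ш(B)` finite by Hu–Shu–Yin / GZK, `Ш(A)` by
Burungale–Flach). Two even integers `a ≤ b + 1` satisfy `a ≤ b`. Hence:

* per member: `missingLowerBoundAt_of_pairBound_add_one` (pair bound `+ 1 ⇒` LOWER at `B`),
  `missingUpperBoundAt_of_pairBound_add_one` (`⇒` UPPER at `B`); single-curve currency:
  `even_padicValRat_shaAn` (`ord₂ #Ш_an(E_p)` is even), `missingLowerBoundAt_of_le_add_one`,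
  `missingUpperBoundAt_of_le_add_one`, and **`bsdp_two_of_abs_sub_le_one`**:
  `|ord₂ #Ш(E_p)[2^∞] − ord₂ #Ш_an(E_p)| ≤ 1 ⇒ BSD(E_p, 2)` — on 𝒞_HSY the `2`-part of BSD holds as
  soon as it holds up to a factor `2`; `cmAtTwo_of_abs_sub_le_one` (leaf form).
* class level: **`lowerOfFacts_iff_pairBound_add_one`** — the crux 19477 is EQUIVALENT to «granted
  the facts, for all members and partners `ord₂ (#Ш_an(B)·#Ш_an(A)) ≤ ord₂ #Ш(B)[2^∞] +
  ord₂ #Ш(A)[2^∞] + 1`»: a Kolyvagin-structure / `m_∞`-type argument for the pair (memo two §34.2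
  (L-K♮): `m_∞ ≤ ord₂ c₃(E_p)`) may LOSE ONE FACTOR `2` and still close the LOWER half;
  **`upperOfFacts_iff_pairBound_add_one`** (+ `upperOfFactsPlus_of_pairBound_add_one` for the live
  twin 19725) — the UPPER crux is equivalent to a `2`-adic Kolyvagin bound for the pair WITH CONSTANT
  `2¹`: of the `τ`-eigenspace defect bits of the off-`𝒱₀` line (k7t-c2, `…UpperOffV0EisensteinConj`:
  `[N : N⁺ + N⁻] = 2`; memo two §34.2 (K4) «each use costs at most ONE factor 2») exactly one is free.

WHAT THIS IS NOT: not a proof of either half for any `p`; no Heegner point, no Euler system, no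
descent is run; `TwoAdicPairHSY` enters BY NAME as a hypothesis (its closure is the cascade 19725 →
`TwoAdicPairHSYOfFactsPlusOfThmC`, not this file); the Cassels–Tate pairing is the named published
fact `exists_casselsTate_pairing` (Cassels 1962; Silverman X.4.14), not proved in the tree; nothing is
booked, no label moves, BSD is not claimed. References: [Cassels1962ArithmeticIV]; [SilvermanAEC2009]
Thm. X.4.14; [HuShuYin2019] Thm. 1.4, Cor. 4.4, (bsd) p. 12; [BurungaleFlach2024] Thm. 1.1, Cor. 2;
[Miller2011LMS] Def. 1.1; [Kolyvagin1990] Thm. A; [GrossZagier1986] I.(6.5); parents p431591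
(`…UpperPairForm`), p417655 (`…LowerHalfContent`).
-/

set_option autoImplicit false
set_option linter.dupNamespace false

noncomputable section

open scoped Classical

open WeierstrassCurve NumberField Literature.NumberTheory.EllipticCurves
  Literature.NumberTheory.EllipticCurves.Rank1Residual
  Literature.NumberTheory.EllipticCurves.Rank1Residual.Typed
  Literature.NumberTheory.EllipticCurves.HuShuYin2019
  Summit.BirchSwinnertonDyer.Rank1Residual
  Summit.BirchSwinnertonDyer.BirchSwinnertonDyer.Theses.SylvesterTwoHeegnerIndex

namespace Summit.BirchSwinnertonDyer.BirchSwinnertonDyer.Theorems.SylvesterTwoOneBit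

/-- §0 Arithmetic. Two even integers with `a ≤ b + 1` satisfy `a ≤ b`. [folklore] -/
theorem le_of_even_of_even_of_le_add_one {a b : ℤ} (ha : Even a) (hb : Even b) (h : a ≤ b + 1) :
    a ≤ b := by
  obtain ⟨k, rfl⟩ := ha
  obtain ⟨l, rfl⟩ := hb
  omega

/-! ## §1 Cassels–Tate: `ord₂ #Ш(E)[2^∞]` is even for a finite `Ш` -/

/-- **Cassels–Tate evenness at `2`.** Granted the Cassels–Tate pairing fact (alternating, kernel the
divisible elements), a finite `Ш(E/ℚ)` has square order, so `ord₂ #Ш(E)[2^∞] = ord₂ #Ш(E)` is even.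
[cite: SilvermanAEC2009, Thm. X.4.14] [cite: Cassels1962ArithmeticIV] -/
theorem even_padicValNat_card_primaryComponent_two
    (hCT : WeierstrassCurve.exists_casselsTate_pairing (K := ℚ))
    (W : WeierstrassCurve ℚ) [W.IsElliptic] [Finite W.sha] :
    Even (padicValNat 2 (Nat.card (AddCommGroup.primaryComponent W.sha 2))) := by
  haveI : Fact (2 : ℕ).Prime := ⟨Nat.prime_two⟩
  obtain ⟨s, hs⟩ := WeierstrassCurve.isSquare_card_sha_of_finite_of_casselsTate hCT W
  have hs0 : s ≠ 0 := by
    rintro rfl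
    exact (Nat.card_pos (α := W.sha)).ne' (by simpa using hs)
  rw [padicValNat_card_addPrimaryComponent 2, hs, padicValNat.mul hs0 hs0]
  exact ⟨_, rfl⟩

/-! ## §2 The Hu–Shu–Yin pair `(E_p, E_{3p²})`: three even quantities -/

section Pair

variable {p : ℕ}

/-- **Both `Ш`-valuations of the pair are even** (Cassels–Tate twice; `Ш(B)` finite by Hu–Shu–Yin /
GZK, `Ш(A)` finite by Burungale–Flach with `L(A,1) ≠ 0` from modularity). [cite: SilvermanAEC2009, Thm. X.4.14]
[cite: HuShuYin2019, Thm. 1.3 and p. 4] [cite: BurungaleFlach2024, Thm. 1.1 and Cor. 2] -/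
theorem even_pairSha (hHSY : thm14_threePart_product)
    (hCM0 : bsdTriple_of_hasCM_of_L_one_ne_zero) (hmod : hasEntireLFunction_rat)
    (hCT : WeierstrassCurve.exists_casselsTate_pairing (K := ℚ))
    (hp : p.Prime) (h9 : p % 9 = 4 ∨ p % 9 = 7) (h3 : ¬ ∃ x : ZMod p, x ^ 3 = 3)
    (A B : WeierstrassCurve ℚ) [A.IsElliptic] [A.IsGloballyMinimal] [B.IsElliptic]
    [B.IsGloballyMinimal] (hB : ∃ C : VariableChange ℚ, C • B = cubeSumCurve (p : ℚ))
    (hA : ∃ C : VariableChange ℚ, C • A = cubeSumCurve (3 * (p : ℚ) ^ 2)) :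
    Even ((padicValNat 2 (Nat.card (AddCommGroup.primaryComponent B.sha 2)) : ℤ) +
      (padicValNat 2 (Nat.card (AddCommGroup.primaryComponent A.sha 2)) : ℤ)) := by
  obtain ⟨-, -, hfinB, -, hA0, -⟩ := hHSY p hp h9 h3 A B hB hA
  haveI : Finite B.sha := hfinB
  have hL : A.entireLFunction 1 ≠ 0 := (A.analyticRank_eq_zero_iff_holds (hmod A)).1 hA0
  have hT : A.BSDTriple := hCM0 A (hasCM_of_variableChange_eq hA) hL
  haveI : Finite A.sha := hT.2.1
  obtain ⟨kB, hkB⟩ := even_padicValNat_card_primaryComponent_two hCT B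
  obtain ⟨kA, hkA⟩ := even_padicValNat_card_primaryComponent_two hCT A
  exact ⟨(kB : ℤ) + kA, by rw [hkB, hkA]; push_cast; ring⟩

/-- **`ord₂ #Ш_an(E_p)` is even.** Pair parity (`TwoAdicPairHSY`: `ord₂ (#Ш_an(B)·#Ш_an(A)) = 2n`)
minus the partner's `ord₂ #Ш_an(A) = ord₂ #Ш(A)[2^∞]` (Burungale–Flach), which is even (Cassels–Tate).
[cite: HuShuYin2019, Cor. 4.4 and (bsd) p. 12] [cite: BurungaleFlach2024, Thm. 1.1 and Cor. 2]
[cite: SilvermanAEC2009, Thm. X.4.14] -/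
theorem even_padicValRat_shaAn (hHSY : thm14_threePart_product)
    (hCM0 : bsdTriple_of_hasCM_of_L_one_ne_zero) (hmod : hasEntireLFunction_rat)
    (hCT : WeierstrassCurve.exists_casselsTate_pairing (K := ℚ)) (hBC : TwoAdicPairHSY)
    (hp : p.Prime) (h9 : p % 9 = 4 ∨ p % 9 = 7) (h3 : ¬ ∃ x : ZMod p, x ^ 3 = 3)
    (A B : WeierstrassCurve ℚ) [A.IsElliptic] [A.IsGloballyMinimal] [B.IsElliptic]
    [B.IsGloballyMinimal] (hB : ∃ C : VariableChange ℚ, C • B = cubeSumCurve (p : ℚ))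
    (hA : ∃ C : VariableChange ℚ, C • A = cubeSumCurve (3 * (p : ℚ) ^ 2)) :
    ∃ qB : ℚ, shaAn B = (qB : ℂ) ∧ qB ≠ 0 ∧ Even (padicValRat 2 qB) := by
  haveI : Fact (2 : ℕ).Prime := ⟨Nat.prime_two⟩
  obtain ⟨-, -, qB, qA, hqB, hqA, hqB0, hqA0, hvA⟩ :=
    SylvesterTwoUpper.pair_shaAn_two hHSY hCM0 hmod hp h9 h3 A B hB hA
  obtain ⟨qB', qA', hqB', hqA', -, n, hn⟩ := hBC p hp h9 h3 A B hB hA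
  have hqq : qB' = qB := by exact_mod_cast hqB'.symm.trans hqB
  have hqq' : qA' = qA := by exact_mod_cast hqA'.symm.trans hqA
  subst hqq hqq'
  obtain ⟨-, -, -, -, hA0, -⟩ := hHSY p hp h9 h3 A B hB hA
  have hL : A.entireLFunction 1 ≠ 0 := (A.analyticRank_eq_zero_iff_holds (hmod A)).1 hA0
  have hT : A.BSDTriple := hCM0 A (hasCM_of_variableChange_eq hA) hL
  haveI : Finite A.sha := hT.2.1
  obtain ⟨kA, hkA⟩ := even_padicValNat_card_primaryComponent_two hCT A
  refine ⟨qB', hqB, hqB0, (n : ℤ) - kA, ?_⟩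
  rw [padicValRat.mul hqB0 hqA0, hvA, hkA] at hn
  push_cast at hn
  linarith

/-- **LOWER at a member, one bit free.** Granted Hu–Shu–Yin, Burungale–Flach, modularity,
Cassels–Tate and the pair parity `TwoAdicPairHSY`: if `ord₂ (#Ш_an(B)·#Ш_an(A)) ≤ ord₂ #Ш(B)[2^∞] +
ord₂ #Ш(A)[2^∞] + 1` then already `MissingLowerBoundAt B 2` (both sides are even).
[cite: HuShuYin2019, Cor. 4.4 and (bsd) p. 12] [cite: SilvermanAEC2009, Thm. X.4.14]
[cite: BurungaleFlach2024, Thm. 1.1 and Cor. 2] [cite: Miller2011LMS, Def. 1.1] -/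
theorem missingLowerBoundAt_of_pairBound_add_one (hHSY : thm14_threePart_product)
    (hCM0 : bsdTriple_of_hasCM_of_L_one_ne_zero) (hmod : hasEntireLFunction_rat)
    (hCT : WeierstrassCurve.exists_casselsTate_pairing (K := ℚ)) (hBC : TwoAdicPairHSY)
    (hp : p.Prime) (h9 : p % 9 = 4 ∨ p % 9 = 7) (h3 : ¬ ∃ x : ZMod p, x ^ 3 = 3)
    (A B : WeierstrassCurve ℚ) [A.IsElliptic] [A.IsGloballyMinimal] [B.IsElliptic]
    [B.IsGloballyMinimal] (hB : ∃ C : VariableChange ℚ, C • B = cubeSumCurve (p : ℚ))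
    (hA : ∃ C : VariableChange ℚ, C • A = cubeSumCurve (3 * (p : ℚ) ^ 2))
    (h : ∃ qB qA : ℚ, shaAn B = (qB : ℂ) ∧ shaAn A = (qA : ℂ) ∧ qB * qA ≠ 0 ∧
      padicValRat 2 (qB * qA) ≤
        (padicValNat 2 (Nat.card (AddCommGroup.primaryComponent B.sha 2)) : ℤ) +
          (padicValNat 2 (Nat.card (AddCommGroup.primaryComponent A.sha 2)) : ℤ) + 1) :
    MissingLowerBoundAt B 2 := by
  obtain ⟨qB, qA, hqB, hqA, hne, hle⟩ := h
  obtain ⟨qB', qA', hqB', hqA', -, n, hn⟩ := hBC p hp h9 h3 A B hB hA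
  have hqq : qB' = qB := by exact_mod_cast hqB'.symm.trans hqB
  have hqq' : qA' = qA := by exact_mod_cast hqA'.symm.trans hqA
  subst hqq hqq'
  refine (SylvesterTwoUpper.missingLowerBoundAt_iff_pairBound hHSY hCM0 hmod hp h9 h3 A B hB
    hA).mpr ⟨qB', qA', hqB, hqA, hne, ?_⟩
  have hev := even_pairSha hHSY hCM0 hmod hCT hp h9 h3 A B hB hA
  rw [hn] at hle ⊢
  exact le_of_even_of_even_of_le_add_one ⟨n, by ring⟩ hev hle

/-- **UPPER at a member, one bit free.** Same inputs: if `ord₂ #Ш(B)[2^∞] + ord₂ #Ш(A)[2^∞] ≤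
ord₂ (#Ш_an(B)·#Ш_an(A)) + 1` then already `MissingUpperBoundAt B 2` — a `2`-adic Kolyvagin bound for
the pair with constant `2¹` is as good as the sharp one. [cite: HuShuYin2019, Cor. 4.4 and (bsd) p. 12]
[cite: SilvermanAEC2009, Thm. X.4.14] [cite: Kolyvagin1990, Thm. A] [cite: Miller2011LMS, Def. 1.1] -/
theorem missingUpperBoundAt_of_pairBound_add_one (hHSY : thm14_threePart_product)
    (hCM0 : bsdTriple_of_hasCM_of_L_one_ne_zero) (hmod : hasEntireLFunction_rat)
    (hCT : WeierstrassCurve.exists_casselsTate_pairing (K := ℚ)) (hBC : TwoAdicPairHSY)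
    (hp : p.Prime) (h9 : p % 9 = 4 ∨ p % 9 = 7) (h3 : ¬ ∃ x : ZMod p, x ^ 3 = 3)
    (A B : WeierstrassCurve ℚ) [A.IsElliptic] [A.IsGloballyMinimal] [B.IsElliptic]
    [B.IsGloballyMinimal] (hB : ∃ C : VariableChange ℚ, C • B = cubeSumCurve (p : ℚ))
    (hA : ∃ C : VariableChange ℚ, C • A = cubeSumCurve (3 * (p : ℚ) ^ 2))
    (h : ∃ qB qA : ℚ, shaAn B = (qB : ℂ) ∧ shaAn A = (qA : ℂ) ∧ qB * qA ≠ 0 ∧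
      (padicValNat 2 (Nat.card (AddCommGroup.primaryComponent B.sha 2)) : ℤ) +
          (padicValNat 2 (Nat.card (AddCommGroup.primaryComponent A.sha 2)) : ℤ) ≤
        padicValRat 2 (qB * qA) + 1) :
    MissingUpperBoundAt B 2 := by
  obtain ⟨qB, qA, hqB, hqA, hne, hle⟩ := h
  obtain ⟨qB', qA', hqB', hqA', -, n, hn⟩ := hBC p hp h9 h3 A B hB hA
  have hqq : qB' = qB := by exact_mod_cast hqB'.symm.trans hqB
  have hqq' : qA' = qA := by exact_mod_cast hqA'.symm.trans hqA
  subst hqq hqq'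
  refine (SylvesterTwoUpper.missingUpperBoundAt_iff_pairBound hHSY hCM0 hmod hp h9 h3 A B hB
    hA).mpr ⟨qB', qA', hqB, hqA, hne, ?_⟩
  have hev := even_pairSha hHSY hCM0 hmod hCT hp h9 h3 A B hB hA
  rw [hn] at hle ⊢
  exact le_of_even_of_even_of_le_add_one hev ⟨n, by ring⟩ hle

/-! ## §3 Single-curve currency: `BSD(E_p, 2)` holds as soon as it holds up to a factor `2` -/

/-- **LOWER at a member from `ord₂ #Ш_an(B) ≤ ord₂ #Ш(B)[2^∞] + 1`** (both even: pair parity +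
Burungale–Flach + Cassels–Tate for the analytic side, Cassels–Tate for `Ш(B)`).
[cite: HuShuYin2019, Cor. 4.4 and (bsd) p. 12] [cite: SilvermanAEC2009, Thm. X.4.14]
[cite: Miller2011LMS, Def. 1.1] -/
theorem missingLowerBoundAt_of_le_add_one (hHSY : thm14_threePart_product)
    (hCM0 : bsdTriple_of_hasCM_of_L_one_ne_zero) (hmod : hasEntireLFunction_rat)
    (hCT : WeierstrassCurve.exists_casselsTate_pairing (K := ℚ)) (hBC : TwoAdicPairHSY)
    (hp : p.Prime) (h9 : p % 9 = 4 ∨ p % 9 = 7) (h3 : ¬ ∃ x : ZMod p, x ^ 3 = 3)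
    (A B : WeierstrassCurve ℚ) [A.IsElliptic] [A.IsGloballyMinimal] [B.IsElliptic]
    [B.IsGloballyMinimal] (hB : ∃ C : VariableChange ℚ, C • B = cubeSumCurve (p : ℚ))
    (hA : ∃ C : VariableChange ℚ, C • A = cubeSumCurve (3 * (p : ℚ) ^ 2))
    {qB : ℚ} (hqB : shaAn B = (qB : ℂ))
    (h : padicValRat 2 qB ≤
      (padicValNat 2 (Nat.card (AddCommGroup.primaryComponent B.sha 2)) : ℤ) + 1) :
    MissingLowerBoundAt B 2 := by
  haveI : Fact (2 : ℕ).Prime := ⟨Nat.prime_two⟩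
  obtain ⟨qB', hqB', -, hev⟩ := even_padicValRat_shaAn hHSY hCM0 hmod hCT hBC hp h9 h3 A B hB hA
  have hqq : qB' = qB := by exact_mod_cast hqB'.symm.trans hqB
  subst hqq
  obtain ⟨-, -, hfinB, -⟩ := hHSY p hp h9 h3 A B hB hA
  haveI : Finite B.sha := hfinB
  obtain ⟨kB, hkB⟩ := even_padicValNat_card_primaryComponent_two hCT B
  have hB2 : (padicValNat 2 B.shaOrder : ℤ) =
      padicValNat 2 (Nat.card (AddCommGroup.primaryComponent B.sha 2)) := by
    rw [WeierstrassCurve.shaOrder, ← padicValNat_card_addPrimaryComponent 2]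
  refine ⟨qB', hqB, ?_⟩
  rw [hB2]
  rw [hkB] at h ⊢
  push_cast at h ⊢
  exact le_of_even_of_even_of_le_add_one hev ⟨kB, rfl⟩ h

/-- **UPPER at a member from `ord₂ #Ш(B)[2^∞] ≤ ord₂ #Ш_an(B) + 1`** (both even).
[cite: HuShuYin2019, Cor. 4.4 and (bsd) p. 12] [cite: SilvermanAEC2009, Thm. X.4.14]
[cite: Kolyvagin1990, Thm. A] [cite: Miller2011LMS, Def. 1.1] -/
theorem missingUpperBoundAt_of_le_add_one (hHSY : thm14_threePart_product)
    (hCM0 : bsdTriple_of_hasCM_of_L_one_ne_zero) (hmod : hasEntireLFunction_rat)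
    (hCT : WeierstrassCurve.exists_casselsTate_pairing (K := ℚ)) (hBC : TwoAdicPairHSY)
    (hp : p.Prime) (h9 : p % 9 = 4 ∨ p % 9 = 7) (h3 : ¬ ∃ x : ZMod p, x ^ 3 = 3)
    (A B : WeierstrassCurve ℚ) [A.IsElliptic] [A.IsGloballyMinimal] [B.IsElliptic]
    [B.IsGloballyMinimal] (hB : ∃ C : VariableChange ℚ, C • B = cubeSumCurve (p : ℚ))
    (hA : ∃ C : VariableChange ℚ, C • A = cubeSumCurve (3 * (p : ℚ) ^ 2))
    {qB : ℚ} (hqB : shaAn B = (qB : ℂ))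
    (h : (padicValNat 2 (Nat.card (AddCommGroup.primaryComponent B.sha 2)) : ℤ) ≤
      padicValRat 2 qB + 1) :
    MissingUpperBoundAt B 2 := by
  haveI : Fact (2 : ℕ).Prime := ⟨Nat.prime_two⟩
  obtain ⟨qB', hqB', -, hev⟩ := even_padicValRat_shaAn hHSY hCM0 hmod hCT hBC hp h9 h3 A B hB hA
  have hqq : qB' = qB := by exact_mod_cast hqB'.symm.trans hqB
  subst hqq
  obtain ⟨-, -, hfinB, -⟩ := hHSY p hp h9 h3 A B hB hA
  haveI : Finite B.sha := hfinB
  obtain ⟨kB, hkB⟩ := even_padicValNat_card_primaryComponent_two hCT B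
  have hB2 : (padicValNat 2 B.shaOrder : ℤ) =
      padicValNat 2 (Nat.card (AddCommGroup.primaryComponent B.sha 2)) := by
    rw [WeierstrassCurve.shaOrder, ← padicValNat_card_addPrimaryComponent 2]
  refine ⟨qB', hqB, ?_⟩
  rw [hB2]
  rw [hkB] at h ⊢
  push_cast at h ⊢
  exact le_of_even_of_even_of_le_add_one ⟨kB, rfl⟩ hev h

/-- **`BSD(E_p, 2)` from `BSD(E_p, 2)` up to one bit.** Granted Hu–Shu–Yin, Burungale–Flach, modularity,
GZK, Cassels–Tate and `TwoAdicPairHSY`: for globally minimal `B ≅ E_p` (partner `A ≅ E_{3p²}` present),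
`|ord₂ #Ш(B)[2^∞] − ord₂ #Ш_an(B)| ≤ 1` implies Miller's `BSD(B, 2)`. [cite: Miller2011LMS, Def. 1.1]
[cite: HuShuYin2019, Thm. 1.4 and Cor. 4.4] [cite: SilvermanAEC2009, Thm. X.4.14] -/
theorem bsdp_two_of_abs_sub_le_one (hHSY : thm14_threePart_product)
    (hCM0 : bsdTriple_of_hasCM_of_L_one_ne_zero) (hmod : hasEntireLFunction_rat)
    (hGZK : rank_eq_analyticRank_of_analyticRank_le_one)
    (hCT : WeierstrassCurve.exists_casselsTate_pairing (K := ℚ)) (hBC : TwoAdicPairHSY)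
    (hp : p.Prime) (h9 : p % 9 = 4 ∨ p % 9 = 7) (h3 : ¬ ∃ x : ZMod p, x ^ 3 = 3)
    (A B : WeierstrassCurve ℚ) [A.IsElliptic] [A.IsGloballyMinimal] [B.IsElliptic]
    [B.IsGloballyMinimal] (hB : ∃ C : VariableChange ℚ, C • B = cubeSumCurve (p : ℚ))
    (hA : ∃ C : VariableChange ℚ, C • A = cubeSumCurve (3 * (p : ℚ) ^ 2))
    {qB : ℚ} (hqB : shaAn B = (qB : ℂ))
    (h : |(padicValNat 2 (Nat.card (AddCommGroup.primaryComponent B.sha 2)) : ℤ) -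
      padicValRat 2 qB| ≤ 1) :
    BSDp B 2 := by
  haveI : Fact (2 : ℕ).Prime := ⟨Nat.prime_two⟩
  obtain ⟨hup, hlo⟩ := abs_le.mp h
  have hl : MissingLowerBoundAt B 2 :=
    missingLowerBoundAt_of_le_add_one hHSY hCM0 hmod hCT hBC hp h9 h3 A B hB hA hqB (by linarith)
  have hu : MissingUpperBoundAt B 2 :=
    missingUpperBoundAt_of_le_add_one hHSY hCM0 hmod hCT hBC hp h9 h3 A B hB hA hqB (by linarith)
  obtain ⟨-, hr, -⟩ := hHSY p hp h9 h3 A B hB hA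
  exact bsdp_of_missingPPartAt B 2 hGZK hr.le (missingPPartAt_of_lower_of_upper B 2 hl hu)

end Pair

/-! ## §4 Class level: both cruxes are equivalent to their one-bit weakenings -/

/-- **THE LOWER CRUX, ONE BIT FREE (item 19477).** Granted Cassels–Tate and the pair parity
`TwoAdicPairHSY`, `HeegnerIndexLowerAtTwoHSYOfFacts` holds iff, granted `PublishedFactsTwo`, for all
members `B ≅ E_p` and partners `A ≅ E_{3p²}`:
`ord₂ (#Ш_an(B)·#Ш_an(A)) ≤ ord₂ #Ш(B)[2^∞] + ord₂ #Ш(A)[2^∞] + 1`. So a Kolyvagin-structure argument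
for Hu–Shu–Yin's pair (`#Ш = 4^{m₀ − m_∞}` with `m_∞ ≤ ord₂ c₃(E_p)`, the Kolyvagin-conjecture
direction at the inert `2` of `ℤ[ω]` — OPEN) may lose one factor `2` and still close the LOWER half.
Nothing asserted at class level. [cite: HuShuYin2019, Cor. 4.4 and (bsd) p. 12]
[cite: SilvermanAEC2009, Thm. X.4.14] [cite: GrossZagier1986, I.(6.5) and V.§2]
[cite: BurungaleFlach2024, Thm. 1.1 and Cor. 2] [cite: Miller2011LMS, Def. 1.1] -/
theorem lowerOfFacts_iff_pairBound_add_one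
    (hCT : WeierstrassCurve.exists_casselsTate_pairing (K := ℚ)) (hBC : TwoAdicPairHSY) :
    HeegnerIndexLowerAtTwoHSYOfFacts ↔
      (PublishedFactsTwo → ∀ (p : ℕ), p.Prime → (p % 9 = 4 ∨ p % 9 = 7) → (¬ ∃ x : ZMod p, x ^ 3 = 3) →
        ∀ (A B : WeierstrassCurve ℚ) [A.IsElliptic] [A.IsGloballyMinimal] [B.IsElliptic]
          [B.IsGloballyMinimal], (∃ C : VariableChange ℚ, C • B = cubeSumCurve (p : ℚ)) →
          (∃ C : VariableChange ℚ, C • A = cubeSumCurve (3 * (p : ℚ) ^ 2)) →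
          ∃ qB qA : ℚ, shaAn B = (qB : ℂ) ∧ shaAn A = (qA : ℂ) ∧ qB * qA ≠ 0 ∧
            padicValRat 2 (qB * qA) ≤
              (padicValNat 2 (Nat.card (AddCommGroup.primaryComponent B.sha 2)) : ℤ) +
                (padicValNat 2 (Nat.card (AddCommGroup.primaryComponent A.sha 2)) : ℤ) + 1) := by
  rw [SylvesterTwoUpper.lowerOfFacts_iff_pairBound]
  refine ⟨fun h hF p hp h9 h3 A B _ _ _ _ hB hA => ?_, fun h hF p hp h9 h3 A B _ _ _ _ hB hA => ?_⟩
  · obtain ⟨qB, qA, hqB, hqA, hne, hle⟩ := h hF p hp h9 h3 A B hB hA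
    exact ⟨qB, qA, hqB, hqA, hne, by linarith⟩
  · have hF' := hF
    obtain ⟨hHSY, hCM0, hmod, -⟩ := hF'
    exact (SylvesterTwoUpper.missingLowerBoundAt_iff_pairBound hHSY hCM0 hmod hp h9 h3 A B hB hA).mp
      (missingLowerBoundAt_of_pairBound_add_one hHSY hCM0 hmod hCT hBC hp h9 h3 A B hB hA
        (h hF p hp h9 h3 A B hB hA))

/-- **THE UPPER CRUX, ONE BIT FREE (items 19476 / 19725 / 19581).** Granted Cassels–Tate and
`TwoAdicPairHSY`, `HeegnerIndexUpperAtTwoHSYOfFacts` holds iff, granted `PublishedFactsTwo`, for all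
members and partners `ord₂ #Ш(B)[2^∞] + ord₂ #Ш(A)[2^∞] ≤ ord₂ (#Ш_an(B)·#Ш_an(A)) + 1`: a `2`-adic
Kolyvagin bound for the pair with constant `2¹` (one `τ`-eigenspace defect bit, memo two §34.2 (K4))
closes the UPPER half. Nothing asserted at class level. [cite: Kolyvagin1990, Thm. A]
[cite: HuShuYin2019, Cor. 4.4 and (bsd) p. 12] [cite: SilvermanAEC2009, Thm. X.4.14]
[cite: BurungaleFlach2024, Thm. 1.1 and Cor. 2] [cite: Miller2011LMS, Def. 1.1] -/
theorem upperOfFacts_iff_pairBound_add_one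
    (hCT : WeierstrassCurve.exists_casselsTate_pairing (K := ℚ)) (hBC : TwoAdicPairHSY) :
    HeegnerIndexUpperAtTwoHSYOfFacts ↔
      (PublishedFactsTwo → ∀ (p : ℕ), p.Prime → (p % 9 = 4 ∨ p % 9 = 7) → (¬ ∃ x : ZMod p, x ^ 3 = 3) →
        ∀ (A B : WeierstrassCurve ℚ) [A.IsElliptic] [A.IsGloballyMinimal] [B.IsElliptic]
          [B.IsGloballyMinimal], (∃ C : VariableChange ℚ, C • B = cubeSumCurve (p : ℚ)) →
          (∃ C : VariableChange ℚ, C • A = cubeSumCurve (3 * (p : ℚ) ^ 2)) →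
          ∃ qB qA : ℚ, shaAn B = (qB : ℂ) ∧ shaAn A = (qA : ℂ) ∧ qB * qA ≠ 0 ∧
            (padicValNat 2 (Nat.card (AddCommGroup.primaryComponent B.sha 2)) : ℤ) +
                (padicValNat 2 (Nat.card (AddCommGroup.primaryComponent A.sha 2)) : ℤ) ≤
              padicValRat 2 (qB * qA) + 1) := by
  rw [SylvesterTwoUpper.upperOfFacts_iff_pairBound]
  refine ⟨fun h hF p hp h9 h3 A B _ _ _ _ hB hA => ?_, fun h hF p hp h9 h3 A B _ _ _ _ hB hA => ?_⟩
  · obtain ⟨qB, qA, hqB, hqA, hne, hle⟩ := h hF p hp h9 h3 A B hB hA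
    exact ⟨qB, qA, hqB, hqA, hne, by linarith⟩
  · have hF' := hF
    obtain ⟨hHSY, hCM0, hmod, -⟩ := hF'
    exact (SylvesterTwoUpper.missingUpperBoundAt_iff_pairBound hHSY hCM0 hmod hp h9 h3 A B hB hA).mp
      (missingUpperBoundAt_of_pairBound_add_one hHSY hCM0 hmod hCT hBC hp h9 h3 A B hB hA
        (h hF p hp h9 h3 A B hB hA))

/-- **The live facts-plus UPPER twin (item 19725), one bit free.** `HeegnerIndexUpperAtTwoHSYOfFactsPlus`
unfolds to `PublishedFactsTwoPlus → HeegnerIndexUpperAtTwoHSY`; so, granted Cassels–Tate and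
`TwoAdicPairHSY`, a pair Kolyvagin bound with constant `2¹` stated behind the facts-plus antecedent
closes it. Nothing asserted at class level. [cite: Kolyvagin1990, Thm. A]
[cite: HuShuYin2019, Cor. 4.4 and (bsd) p. 12] [cite: SilvermanAEC2009, Thm. X.4.14] -/
theorem upperOfFactsPlus_of_pairBound_add_one
    (hCT : WeierstrassCurve.exists_casselsTate_pairing (K := ℚ)) (hBC : TwoAdicPairHSY)
    (h : PublishedFactsTwoPlus → ∀ (p : ℕ), p.Prime → (p % 9 = 4 ∨ p % 9 = 7) →
      (¬ ∃ x : ZMod p, x ^ 3 = 3) →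
        ∀ (A B : WeierstrassCurve ℚ) [A.IsElliptic] [A.IsGloballyMinimal] [B.IsElliptic]
          [B.IsGloballyMinimal], (∃ C : VariableChange ℚ, C • B = cubeSumCurve (p : ℚ)) →
          (∃ C : VariableChange ℚ, C • A = cubeSumCurve (3 * (p : ℚ) ^ 2)) →
          ∃ qB qA : ℚ, shaAn B = (qB : ℂ) ∧ shaAn A = (qA : ℂ) ∧ qB * qA ≠ 0 ∧
            (padicValNat 2 (Nat.card (AddCommGroup.primaryComponent B.sha 2)) : ℤ) +
                (padicValNat 2 (Nat.card (AddCommGroup.primaryComponent A.sha 2)) : ℤ) ≤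
              padicValRat 2 (qB * qA) + 1) :
    HeegnerIndexUpperAtTwoHSYOfFactsPlus := fun hFP =>
  SylvesterTwoUpper.upperOfFacts_iff.mp
    ((upperOfFacts_iff_pairBound_add_one hCT hBC).mpr fun _ => h hFP) hFP.1

/-- **The rung leaf, one bit free.** Granted `PublishedFactsTwo`, Cassels–Tate and `TwoAdicPairHSY`:
if every globally minimal model `B` of every member of 𝒞_HSY satisfies `BSD(B, 2)` UP TO ONE BIT
(`|ord₂ #Ш(B)[2^∞] − ord₂ #Ш_an(B)| ≤ 1` for the rational `#Ш_an(B)`), then the K7t leaf `X12.CMAtTwo`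
(`BSD(E_p, 2)` on the class) holds. Nothing asserted at class level. [cite: Miller2011LMS, Def. 1.1]
[cite: HuShuYin2019, Thm. 1.4 and Cor. 4.4] [cite: SilvermanAEC2009, Thm. X.4.14 and VIII.8 Cor. 8.3] -/
theorem cmAtTwo_of_abs_sub_le_one (hF : PublishedFactsTwo)
    (hCT : WeierstrassCurve.exists_casselsTate_pairing (K := ℚ)) (hBC : TwoAdicPairHSY)
    (h : ∀ (p : ℕ), p.Prime → (p % 9 = 4 ∨ p % 9 = 7) → (¬ ∃ x : ZMod p, x ^ 3 = 3) →
      ∀ (B : WeierstrassCurve ℚ) [B.IsElliptic] [B.IsGloballyMinimal],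
        (∃ C : VariableChange ℚ, C • B = cubeSumCurve (p : ℚ)) →
        ∃ qB : ℚ, shaAn B = (qB : ℂ) ∧
          |(padicValNat 2 (Nat.card (AddCommGroup.primaryComponent B.sha 2)) : ℤ) -
            padicValRat 2 qB| ≤ 1) :
    X12.CMAtTwo := by
  have hF' := hF
  obtain ⟨hHSY, hCM0, hmod, -, -, -, -, hGZK, -⟩ := hF'
  intro p hp h9 h3 B _ _ hB
  have hn : (3 * (p : ℚ) ^ 2) ≠ 0 :=
    mul_ne_zero (by norm_num) (pow_ne_zero _ (Nat.cast_ne_zero.mpr hp.ne_zero))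
  haveI := X12.CubeSumFamilies.isElliptic_cubeSumCurve hn
  obtain ⟨A, _, _, CA, hCA⟩ :=
    X12.CubeSumFamilies.exists_isGloballyMinimal_model (cubeSumCurve (3 * (p : ℚ) ^ 2))
  obtain ⟨qB, hqB, hq⟩ := h p hp h9 h3 B hB
  exact bsdp_two_of_abs_sub_le_one hHSY hCM0 hmod hGZK hCT hBC hp h9 h3 A B hB ⟨CA, hCA⟩ hqB hq

end Summit.BirchSwinnertonDyer.BirchSwinnertonDyer.Theorems.SylvesterTwoOneBit

end
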